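import Mathlib.Analysis.ODE.ExistUnique
import Mathlib.Analysis.Complex.Basic
import HarnessLib

/-!
# An autonomous ODE whose field is constant on a ball: solutions are straight lines while the line stays in the ball

Family `hodge`, layer `Literature/Analysis/Calculus`; a one-dimensional comparison lemma for the pencil coordinate along the cut-off monodromy
flows (programme discharging `AlgebraicGeometry/HodgeTheory/CyclicCoverNodalMeridianLocalMonodromyBound`): along an orbit the pencil
coordinate `q(s)` solves `q' = v(q)` with `v` Lipschitz and EQUAL TO THE CONSTANT `u` on the ball `‖z‖ < ρ` (the coefficient cut-offs are `1`
there); the line `s ↦ q(0) + s·u` solves the same equation as long as it stays in the ball, so by uniqueness (Picard–Lindelöf / Gronwall,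
`Mathlib.Analysis.ODE.ExistUnique`) `q(s) = q(0) + s·u` on every time segment `[0, t]` on which `‖q(0) + s·u‖ < ρ`.

* `eq_add_mul_of_hasDerivAt_of_eqOn_ball` — the statement above (both time directions).

Everything is proved; no definitions, no named facts.

## References

* [BrockerJanichIDT1982] T. Bröcker, K. Jänich, Introduction to Differential Topology (1982), (8.12) (flows of lifted constant fields).
* [LeeSmoothManifolds2013] J. M. Lee, Introduction to Smooth Manifolds (2013), Thm. D.1 (ODE uniqueness).
-/

noncomputable section

open Set

namespace Literature.Analysis.Calculus

/-- **Solutions of `q' = v(q)` are straight lines while the line stays where `v ≡ u`.** Let `v : E → E` be Lipschitz with `v z = u` for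
`‖z‖ < ρ`, `q : ℝ → E` with `q' (s) = v (q s)` for all `s`, and `t` a time with `‖q 0 + s • u‖ < ρ` for all `s` between `0` and `t`. Then
`q s = q 0 + s • u` for all `s` between `0` and `t`. [cite: LeeSmoothManifolds2013, Thm. D.1] [cite: BrockerJanichIDT1982, (8.12)] -/
theorem eq_add_smul_of_hasDerivAt_of_eqOn_ball {E : Type*} [NormedAddCommGroup E] [NormedSpace ℝ E]
    {v : E → E} {K : NNReal} (hv : LipschitzWith K v) {u : E} {ρ : ℝ} (hvu : ∀ z, ‖z‖ < ρ → v z = u)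
    {q : ℝ → E} (hq : ∀ s, HasDerivAt q (v (q s)) s) {t : ℝ} (hseg : ∀ s ∈ uIcc 0 t, ‖q 0 + s • u‖ < ρ)
    {s : ℝ} (hs : s ∈ uIcc 0 t) :
    q s = q 0 + s • u := by
  -- the comparison line
  set g : ℝ → E := fun s => q 0 + s • u with hg
  have hgd : ∀ s, HasDerivAt g u s := fun s => by
    have h := ((hasDerivAt_id s).smul_const u).const_add (q 0)
    simpa [hg] using h
  have hgv : ∀ s ∈ uIcc 0 t, HasDerivAt g (v (g s)) s := fun s hs' => by
    rw [hvu (g s) (hseg s hs')]; exact hgd s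
  have hqc : Continuous q := continuous_iff_continuousAt.mpr fun s => (hq s).continuousAt
  have hgc : Continuous g := continuous_iff_continuousAt.mpr fun s => (hgd s).continuousAt
  rcases le_total 0 t with ht | ht
  · rw [uIcc_of_le ht] at hseg hs
    have h := ODE_solution_unique_of_mem_Icc_right (v := fun _ => v) (s := fun _ => (univ : Set E)) (K := K)
      (f := q) (g := g) (a := 0) (b := t)
      (fun t' _ => hv.lipschitzOnWith) hqc.continuousOn (fun t' _ => (hq t').hasDerivWithinAt) (fun _ _ => mem_univ _)
      hgc.continuousOn (fun t' ht' => (hgv t' (by rw [uIcc_of_le ht]; exact Ico_subset_Icc_self ht')).hasDerivWithinAt)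
      (fun _ _ => mem_univ _)
      (by simp [hg])
    exact h hs
  · rw [uIcc_of_ge ht] at hseg hs
    have h := ODE_solution_unique_of_mem_Icc_left (v := fun _ => v) (s := fun _ => (univ : Set E)) (K := K)
      (f := q) (g := g) (a := t) (b := 0)
      (fun t' _ => hv.lipschitzOnWith) hqc.continuousOn (fun t' _ => (hq t').hasDerivWithinAt) (fun _ _ => mem_univ _)
      hgc.continuousOn (fun t' ht' => (hgv t' (by rw [uIcc_of_ge ht]; exact Ioc_subset_Icc_self ht')).hasDerivWithinAt)
      (fun _ _ => mem_univ _)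
      (by simp [hg])
    exact h hs

end Literature.Analysis.Calculus

end
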